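import Mathlib
import Summits.Langlands.Langlands.Theses.PhantomRMYoshida
import Literature.NumberTheory.GaloisRepresentations.SerreWeight
import Literature.NumberTheory.GaloisRepresentations.ResidualPair
import Literature.NumberTheory.Automorphic.AdicCompletionLocalField
import Literature.NumberTheory.DiophantineGeometry.AVGaloisModule
import Literature.NumberTheory.DiophantineGeometry.AbelianVarietyOrdinaryReduction
import Summits.Langlands.Langlands.Theorems.PhantomRMYoshidaStableYoshidaCongruenceCharpolyCongruence
import Literature.AlgebraicGeometry.Motives.FaltingsAbelian
import Literature.NumberTheory.DiophantineGeometry.AVGaloisModuleContinuityProofs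
import Literature.NumberTheory.GaloisRepresentations.FramedRepBaseChange
import Literature.FieldTheory.AlgClosed.PadicAlgClEquivComplex
import Summits.Langlands.Langlands.Theorems.PhantomRMYoshidaStableYoshidaCongruenceTateModuleIrreducible
import Summits.Langlands.Langlands.Theorems.PhantomRMYoshidaStableYoshidaCongruenceDistinguishedTransferLocal
import Summits.Langlands.Langlands.Theorems.PhantomRMYoshidaStableYoshidaCongruenceTateModuleGreenberg
import Summits.Langlands.Langlands.Theorems.PhantomRMYoshidaStableYoshidaCongruenceSwitchToModularSurface
import Summits.Langlands.Langlands.Theorems.PhantomRMYoshidaStableYoshidaCongruenceSector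

/-!
# Line `level-three-weierstrass-switch` — checked skeleton for the crux
`Summit.Langlands.Langlands.Theses.PhantomRMYoshida.StableYoshidaCongruence` (stmt-Langlands-13640)

Planner crux-plan, round 1 (idea card `level-three-weierstrass-switch`, ideator 2; triage r1: pass ×3,
merge ≈ `burkhardt-weddle-two-three-anchor`; line card `Lines/level-three-weierstrass-switch.md`).

## The line (p = 3 sector lever, in print)

The crux asks, for every odd `p` and every eligible residual Yoshida pair `(σ̄, σ̄')` with SOME
Greenberg-ordinary `p`-distinguished symplectic-`ε⁻¹` lift `ρ` (H5, possibly reducible), for an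
IRREDUCIBLE AUTOMORPHIC lift `ρ₀` of the same shape.  Expected dimension of the relevant deformation
problem is `-1` (Disproof.lean §6): lifts are accidents — motives or functorial constructions.  This
line supplies the MOTIVE when one is available for free: at `p = 3` the twisted moduli space
`P(ρ̄)` of principally polarised abelian surfaces with full level-`3` structure of type
`ρ̄ : Γ_ℚ → GSp₄(𝔽₃)` is RATIONAL (a twist of the Burkhardt quartic; BoxerEtAl2021 §10.2,
"Weddle surface" presentation), so genus-2 curves with a rational Weierstrass point and
`Jac(X)[3] ≅ ρ̄` exist with prescribed behaviour at `2`, `3`, `∞` and away from a thin set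
(BoxerCalegariGeePilloni2025 = arXiv:2502.20645, Lemma 9.4.1 (Ekedahl-type approximation on a
rational variety), Lemma 9.4.2 "switching", Remark 9.4.3/9.4.4): `B = Jac(X)` has `ρ̄_{B,3} ≅ ρ̄`,
good ordinary reduction at `3`, `End(B_ℚ̄) = ℤ`, and mod-`2` image `S₅(b)` with ordinary
`2`-distinguished reduction at `2`, whence `B` is MODULAR by the 2-adic theorem
(arXiv:2502.20645 §8.3 main Theorem (held-text Thm 386) "residually `A₅(b)`", no hypothesis at `3`, exactly as in the first half
of the proof of Thm 9.5.2), and its weight-2 `π` on `GSp₄/ℚ` transfers to a cuspidal `Π` on `GL₄`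
(Arthur / Gee–Taïbi, as in the statement of Thm 9.5.2).  Then `ρ₀ := H¹_ét(B_ℚ̄, ℚ̄₃)` (the
contragredient of the rational `3`-adic Tate module) is irreducible (Faltings + `End = ℤ`),
symplectic with multiplier `ε⁻¹` (Weil pairing), Greenberg-ordinary of shape `(0,0,1,1)` at `3`
(Serre–Tate, good ordinary reduction), residually `σ̄ ⊕ σ̄'` (since `ρ̄_{B,3} ≅ ρ̄`), residually
`3`-distinguished (transferred from the H5-witness: distinguishedness is a property of the residual
pair — the ONLY place H5 is used), and automorphic: `CruxAt 3` holds on the sector, REDUCIBLE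
witnesses included (the lever never looks at the witness beyond its residual shape at `3`).

THE SECTOR (`p = 3 ∧ Switchable 3 k σ σ'`): `σ̄ ⊕ σ̄'` admits a `GSp₄(𝔽₃)`-model `ρ̄` (both
`𝔽₃`-rational, or the phantom-RM case `σ̄' = σ̄^(3)` over `𝔽₉` — the route's motivating case)
which is ordinary-with-unramified-sub and PEU RAMIFIÉ at `3` (= "`ρ̄^∨|_{Γ_{ℚ₃}}` ordinary and
finite flat", the hypothesis of Lemma 9.4.2: H5 alone allows très ramifié / multiplicative
witnesses, which are OUTSIDE the printed lemma — triage r1-1/r1-2 sharpening) and unramified at `2`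
with `charpoly ρ̄(Frob₂) ≠ (X² ± X + 2)²` (the `4C/12C` condition in the form of Thm 9.5.2 (2)).
Outside the sector (all `p ≥ 5`: `A₂(p)`-twists are of general type, Hulek–Sankaran, no Diophantine
supply; and the `p = 3` pairs with no switchable model) the line says NOTHING: that is the honest
remainder stub `stub_offSectorRemainder`, which is the crux restricted off the sector (regimes R4 and
the D-residue of Disproof §5) — NOT claimed by this line; the lead should hand it back
(`promote-stub`) or the tenure planner should restate the item (Irr' / sector), cf. all three
triage notes and Disproof `closes_irr'`.

## Shape (data flow of `StableYoshidaCongruence_of`, sorry-free glue at the end of the file)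

`crux_iff` (`Iff.rfl`, Disproof §0 vocabulary re-declared here because `Cruxes/**` work files are
not importable) turns the crux into `∀ p ≠ 2, ∀ k red σ σ', CruxAt p k red σ σ'`; classical case
split on `p = 3 ∧ Switchable p k σ σ'`:
* in the sector: `stub_switchToModularSurface` (the 2–3 switch, XL, in print) gives
  `B, b, ρ₀` with `TateFrame`, `dim B = 2`, good ordinary at `3`, `End = ℤ`, symplectic-`ε⁻¹`,
  `HasResidualPair red σ σ'`, `AutGL4`; `stub_tateModuleIrreducible` (Faltings) and
  `stub_tateModuleGreenberg` (Serre–Tate) — assembled as `tateModuleDictionary` — give irreducibility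
  and the Greenberg shape; `stub_charpolyCongruence` (Chebotarev + continuity) and
  `stub_distinguishedTransferLocal` (local residual characters, Brauer–Nesbitt) — assembled as
  `distinguishedTransfer` — move residual distinguishedness from the H5-witness `ρ` to `ρ₀`;
  assemble `⟨ρ₀, irr, Sh, AutGL4⟩`;
* off the sector: `stub_offSectorRemainder`.

LEAD RESHAPE (line lead prover-line-stmt-Langlands-13640-0, 2026-08-16): the planner's 4 stubs became 6
(≤ stubs_max 7) by splitting `stub_distinguishedTransfer` into its global/local halves and
`stub_tateModuleDictionary` along its two named-fact dependencies; the compositions are proved here, the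
glue is otherwise byte-identical in logic.

## Disproof used (Cruxes/StableYoshidaCongruence/Disproof.lean, cdisprove cycle 3, read in full)

* §2 `exists_cuspForm_of_not_crux`: no `_false_without_H` theorem exists for this crux (the
  automorphic wall) — nothing to honour by name; the load-bearing analysis §4 is honoured instead:
  H5 (`∃ ρ, Sh ρ`) is THE load-bearing hypothesis and "only ever certifies the reducible witness" —
  this line uses H5 exactly once, in `stub_distinguishedTransfer` (residual `3`-distinguishedness of
  `ρ₀`), and needs nothing else from the witness, which is why it covers the reducible-witness
  surplus (no Irr'-trap, §3.2); H1/H1' (`AutGL2`) are not consumed (decoration, §3.5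
  `cruxNoAutAt_iff_of_KW`); H3/H4 are passed only to the remainder stub.
* §5 R2 is this line; R1/D1 (functorial pairs) and R4/D-residue are inside `stub_offSectorRemainder`.
* §6 "accidents only": the `+1` missing dimension is supplied by the rational moduli space, not by
  a lifting theorem — the barrier catalogue (NonRegularWeight / ResiduallyReducible /
  TaylorWilesNumericalCoincidence) constrains lifting METHODS and does not touch a motivic
  construction (triage r1-1 on the sister card).
* Negative lemmas landed under `Theorems/StableYoshidaCongruence/Negative/`: none (nothing to
  import); negatives index: 1 unrelated entry (K3 Kuga–Satake); no stub is an instance of a refuted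
  statement.
-/

set_option linter.dupNamespace false
set_option linter.unusedVariables false

noncomputable section

open CategoryTheory IsDedekindDomain
open scoped NumberField
open Literature.NumberTheory.GaloisRepresentations Literature.NumberTheory.Automorphic
open Literature.AlgebraicGeometry.Motives (AbelianVariety)
open Summit.Langlands.Langlands.Theses.PhantomRMYoshida
open Literature.NumberTheory.DiophantineGeometry (weilPairing_rationalTateModule
  ordinaryReduction_tateModule_filtration bcgp_switch_exists_modular_abelianSurface)

namespace Summit.Langlands.Langlands.Cruxes.StableYoshidaCongruence.LevelThreeWeierstrassSwitch

/-! ## Vocabulary I (`invCyc`, `Sh`, `AutGL2`, `AutGL4`, `DetCond`, `NonConj`, `CruxAt`, `crux_iff`) — now DECLARED by the landed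
Sector file `Theorems/PhantomRMYoshidaStableYoshidaCongruenceSector.lean` (p94938, same names, this namespace; imported above; verbatim
Disproof.lean §0, `crux_iff : StableYoshidaCongruence ↔ ∀ p ≠ 2 …, CruxAt … := Iff.rfl`). -/

/-! ## Vocabulary II–III (`toK`, `IsModelOf`, `IsOrdinaryFlatAt`, `IsSwitchableAtTwo`, `Switchable`, `TateFrame`,
`EndTrivial`) — now DECLARED by the landed Stub-2 file `Theorems/PhantomRMYoshidaStableYoshidaCongruenceSwitchToModularSurface.lean`
(p92171, same names, this namespace; imported above).  Vocabulary V (`framedH1` & co.) likewise comes with the landed support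
file `…FramedH1.lean` (p91179). -/

/-! ## Vocabulary IV — the three NAMED FACTS the conditional stubs rest on (LEAD RESHAPE v4, 2026-08-16)

Wave-1/2 workers proved Stubs 2, 3i, 3ii CONDITIONALLY: Stub 3i on the EXISTING tree named facts
`Literature.AlgebraicGeometry.Motives.faltings_tate_bijective` / `isSemisimpleRepresentation_rationalTateRep`
(Faltings 1983, Satz 3–4, unproved in Lean), Stub 3ii on the NEW cite fact
`ordinaryReduction_tateModule_filtration` (Serre–Tate ordinary filtration), Stub 2 on the NEW cite facts
`bcgp_switch_exists_modular_abelianSurface` (BCGP2025 Lemma 9.4.2 + Thm 8.3.2 + transfer, as used in the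
proof of Thm 9.5.2) and `weilPairing_rationalTateModule` (Weil pairing, Milne §16 / Mumford §20).  Two of the
three new facts have LANDED under Literature (relocated by the gate from the stub files:
`Literature.NumberTheory.DiophantineGeometry.ordinaryReduction_tateModule_filtration`, p86833, appended to
AbelianVarietyOrdinaryReduction.lean; `Literature.NumberTheory.DiophantineGeometry.weilPairing_rationalTateModule`,
p86824, WeilPairingRationalTateModule.lean); and so has the third
(`Literature.NumberTheory.DiophantineGeometry.bcgp_switch_exists_modular_abelianSurface`, p92170,
BcgpSwitchExistsModularAbelianSurface.lean, relocated from Stub 2's file); all three are used here through `open`.  The skeleton's deciding theorem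
`StableYoshidaCongruence_of` is therefore CONDITIONAL on five named facts (plus the open remainder stub). -/

-- The three new facts are the Literature constants `Literature.NumberTheory.DiophantineGeometry.{ordinaryReduction_tateModule_filtration,
-- bcgp_switch_exists_modular_abelianSurface, weilPairing_rationalTateModule}` (p86833, p92170, p86824), `open`ed above.


/- **Stub 2-support (`stub_framedH1Symplectic`) — LANDED** (p91179): `Theorems/PhantomRMYoshidaStableYoshidaCongruenceFramedH1.lean`
(framed `H¹` dictionary + symplecticity from the Weil fact; imported through the Stub-2 module). -/

/-! ## Fact stubs — the five NAMED FACTS as registered obligations (LEAD RESHAPE v4)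

The gate requires the deciding theorem to be hypothesis-free and every input to be a registered stub
(`skeleton.extra-hypothesis`), so the five named facts enter as `stub_fact_*` obligations.  They are
PUBLISHED THEOREMS, not tasks for stub workers: each is discharged exactly by a `…_holds` proof of the
corresponding Literature fact (Faltings 1983 Satz 3–4 — tree `Literature.AlgebraicGeometry.Motives.*`, no
`_holds` exists; Serre–Tate; BCGP2025; Weil pairing — the three new facts are relocated to
`Literature/NumberTheory/DiophantineGeometry/` when Stubs 2/3ii land).  Until then the line is CLOSED
MODULO these facts + the open remainder (Census: `What is missing`). -/

/-- **Fact stub (Faltings 1983, Satz 4 / Korollar 1: the Tate map `ℤ_p ⊗ End_ℚ(B) → End_Γ(T_p B)` is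
bijective)** — the tree named fact `Literature.AlgebraicGeometry.Motives.faltings_tate_bijective B B p` for
every abelian variety over `ℚ` and every `p`.  Not proved in Lean (no `_holds`); consumed by Stub 3i.
[cite: Faltings1983Endlichkeit, §5 Satz 4 and Korollar 1] -/
theorem stub_fact_faltingsTateBijective :
    ∀ (p : ℕ) [Fact p.Prime] (B : AbelianVariety ℚ),
      Literature.AlgebraicGeometry.Motives.faltings_tate_bijective B B p := by
  sorry

/-- **Fact stub (Faltings 1983, Satz 3: `V_p B` is a semisimple `ℚ_p[Γ_ℚ]`-module)** — the tree named
fact `Literature.AlgebraicGeometry.Motives.isSemisimpleRepresentation_rationalTateRep B p`.  Not proved in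
Lean; consumed by Stub 3i. [cite: Faltings1983Endlichkeit, §5 Satz 3] -/
theorem stub_fact_faltingsSemisimple :
    ∀ (p : ℕ) [Fact p.Prime] (B : AbelianVariety ℚ),
      Literature.AlgebraicGeometry.Motives.isSemisimpleRepresentation_rationalTateRep B p := by
  sorry

/-- **Fact stub (Serre–Tate ordinary filtration of `V_p B` for good ordinary reduction)** — the new cite
fact `ordinaryReduction_tateModule_filtration` (Vocabulary IV; stated inline in Stub 3ii's file, relocated
to Literature by the gate).  Consumed by Stub 3ii. [cite: Greenberg1991, §2; Shatz1986GroupSchemes, §6–§7;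
SerreTate1968GoodReduction, §1] -/
theorem stub_fact_serreTateOrdinaryFiltration : ordinaryReduction_tateModule_filtration := by
  sorry

/-- **Fact stub (BCGP2025: the `2`–`3` switch lands on a modular abelian surface — Lemma 9.4.2 +
Thm 8.3.2 + transfer, as in the proof of Thm 9.5.2)** — the new cite fact
`bcgp_switch_exists_modular_abelianSurface` (Vocabulary IV; stated inline in Stub 2's file).  Consumed by
Stub 2. [cite: BoxerCalegariGeePilloni2025, Lemma 9.4.2, Thm. 8.3.2, Thm. 9.5.2 (arXiv:2502.20645)] -/
theorem stub_fact_bcgpSwitchModular : bcgp_switch_exists_modular_abelianSurface := by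
  sorry

/-- **Fact stub (Weil pairing: `V_p B` is symplectic with multiplier `χ_p`)** — the new cite fact
`weilPairing_rationalTateModule` (Vocabulary IV; stated inline in Stub 2's file).  Consumed by Stub 2.
[cite: Milne1986AbelianVarieties, §16 Lemma 16.1–16.2; MumfordAV1970, §20] -/
theorem stub_fact_weilPairing : weilPairing_rationalTateModule := by
  sorry

/-! ## Stub 1a — charpoly congruence on all of `Γ_ℚ` from a common residual pair (global half of the transfer)

LEAD RESHAPE (2026-08-16, line lead): the planner's `stub_distinguishedTransfer` (M/L) is split at the
skeleton level into a GLOBAL half (`stub_charpolyCongruence`: Chebotarev density + continuity, no local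
input) and a LOCAL half (`stub_distinguishedTransferLocal`: comparison of residual diagonal characters of
two triangular frames at `v ∣ p`); the composition `distinguishedTransfer` below is proved (sorry-free) and
is what the glue consumes.  Same mathematics, two independently landable lemmas. -/

/- **Stub 1a (`stub_charpolyCongruence`) — LANDED** (p78811, 2026-08-16, wave 1):
`Summits/Langlands/Langlands/Theorems/PhantomRMYoshidaStableYoshidaCongruenceCharpolyCongruence.lean`
declares `stub_charpolyCongruence` in THIS namespace with the registered signature (imported above; 190
lines; Chebotarev `frobenius_dense` + clopen congruence set + `Monodromy.continuous_charpoly_coeff`;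
axioms propext/Classical.choice/Quot.sound).  Reusable there: `red_eq_zero_of_norm_lt_one`,
`norm_lt_one_of_red_eq_zero`, `map_red_eq_iff_forall_norm_sub_lt_one` (`ker red = 𝔪`). -/

/-! ## Stub 1b — residual `p`-distinguishedness transfers along a charpoly congruence (local half) -/

/- **Stub 1b (`stub_distinguishedTransferLocal`) — LANDED** (p86922, 2026-08-16; p81712 bounced on a duplicate-lemma
review point and was re-proposed with the fix): `Summits/Langlands/Langlands/Theorems/
PhantomRMYoshidaStableYoshidaCongruenceDistinguishedTransferLocal.lean` declares it in THIS namespace (imported above; 365 lines: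
residual diagonal characters of the two frames, Brauer–Nesbitt for sums of characters, `χ_p(I_{ℚ_v}) ∋ -1` for `p ≠ 2`). -/

/-- **Stub 1 assembled (sorry-free glue): residual `p`-distinguishedness is a property of the residual
pair.**  `p` odd, `r, r'` with the same residual pair `(σ, σ')` through `red`, `r` residually distinguished
and `r'` Greenberg-ordinary of shape `(0,0,1,1)` at `v ∣ p` ⇒ `r'` residually distinguished at `v`.  This is
where the crux's load-bearing hypothesis H5 (`∃ ρ, Sh ρ`) is consumed: `r :=` the H5-witness, `r' := ρ₀`. -/
theorem distinguishedTransfer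
    (p : ℕ) [Fact p.Prime] (hp : p ≠ 2) (k : Type) [Field k] [CharP k p] [TopologicalSpace k]
    (red : Valued.integer (PadicAlgCl p) →+* k)
    (σ σ' : FramedGaloisRep ℚ k 2) (r r' : FramedGaloisRep ℚ (PadicAlgCl p) 4)
    (v : HeightOneSpectrum (𝓞 ℚ)) (hv : ((p : ℕ) : 𝓞 ℚ) ∈ v.asIdeal)
    (hr : r.HasResidualPair red σ σ') (hr' : r'.HasResidualPair red σ σ')
    (hdist : r.IsResiduallyDistinguishedAt v ![0, 0, 1, 1])
    (hGr' : r'.IsGreenbergOrdinaryOfShapeAt v ![0, 0, 1, 1]) :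
    r'.IsResiduallyDistinguishedAt v ![0, 0, 1, 1] :=
  stub_distinguishedTransferLocal p hp k red r r' v hv
    (stub_charpolyCongruence p k red σ σ' r r' hr hr') hdist hGr'

/-! ## Stub 2 — the 2–3 switch lands on a MODULAR abelian surface (hardest; in print) -/

/- **Stub 2 (`stub_switchToModularSurface`) — LANDED** (p92171, 2026-08-16; conditional registered form with the BCGP and Weil
facts as first two hypotheses, both facts relocated by the gate to Literature as p92170 / p86824):
`Summits/Langlands/Langlands/Theorems/PhantomRMYoshidaStableYoshidaCongruenceSwitchToModularSurface.lean` (+ support file `…FramedH1.lean`,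
p91179) declares it in THIS namespace (imported above; BCGP2025 Lemma 9.4.2 + Thm 8.3.2 + transfer as ONE cited Prop over abelian-surface
vocabulary; dictionary: `framedH1`, Weil pairing ⇒ symplectic `ε⁻¹`, `ρ̄_{B,3} ≅ ρb` + `IsModelOf` ⇒ `HasResidualPair`). -/

/-! ## Stub 3 — the Tate-module dictionary, split by the lead into its two named-fact dependencies

LEAD RESHAPE (2026-08-16): the planner's `stub_tateModuleDictionary` (L) is split into
`stub_tateModuleIrreducible` (Faltings: depends on the EXISTING tree named facts `faltings_tate_bijective`,
`isSemisimpleRepresentation_rationalTateRep`) and `stub_tateModuleGreenberg` (Serre–Tate: needs a NEW cite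
fact, "good ordinary ⇒ ordinary Tate module", explicitly "not recorded" in
AbelianVarietyOrdinaryReduction.lean); the composition `tateModuleDictionary` is proved below.  The two
stub signatures INLINE `TateFrame` / `EndTrivial` (definitionally, so the glue applies them to the named
hypotheses unchanged) so that the stub files under `Theorems/` mention only Mathlib + Literature and never
re-declare line vocabulary. -/

/- **Stub 3i (`stub_tateModuleIrreducible`) — LANDED** (p86814, 2026-08-16, wave 3; conditional registered form
with the two Faltings facts as hypotheses): `Summits/Langlands/Langlands/Theorems/
PhantomRMYoshidaStableYoshidaCongruenceTateModuleIrreducible.lean` declares it in THIS namespace (imported above;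
353 lines: scalar commutant from `faltings_tate_bijective` + `End = ℤ`, Burnside span, semisimplicity ⇒ irreducible,
dual frame). -/

/- **Stub 3ii (`stub_tateModuleGreenberg`) — LANDED** (p86843, 2026-08-16; conditional registered form with the Serre–Tate
fact as first hypothesis, the fact itself relocated by the gate to Literature as p86833):
`Summits/Langlands/Langlands/Theorems/PhantomRMYoshidaStableYoshidaCongruenceTateModuleGreenberg.lean` declares it in THIS
namespace (imported above; 357 lines: basis adapted to the Serre–Tate filtration, transpose-inverse frame, commuting 2×2
families triangularised over `ℚ̄_p`). -/

/-- **Stub 3 assembled (sorry-free glue): the Tate-module dictionary.**  An ordinary abelian surface with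
`End_ℚ = ℤ` has irreducible, Greenberg-ordinary `(0,0,1,1)` framed `H¹`. -/
theorem tateModuleDictionary
    (hF : ∀ (p : ℕ) [Fact p.Prime] (B : AbelianVariety ℚ),
        Literature.AlgebraicGeometry.Motives.faltings_tate_bijective B B p)
    (hS : ∀ (p : ℕ) [Fact p.Prime] (B : AbelianVariety ℚ),
        Literature.AlgebraicGeometry.Motives.isSemisimpleRepresentation_rationalTateRep B p)
    (hST : ordinaryReduction_tateModule_filtration)
    (p : ℕ) [Fact p.Prime] (B : AbelianVariety ℚ)
    (b : Module.Basis (Fin 4) ℚ_[p] (B.rationalTateModule p)) (ρ₀ : FramedGaloisRep ℚ (PadicAlgCl p) 4)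
    (hfr : TateFrame p B b ρ₀) (hdim : B.dim = 2)
    (hord : ∀ v : HeightOneSpectrum (𝓞 ℚ), ((p : ℕ) : 𝓞 ℚ) ∈ v.asIdeal → B.HasGoodOrdinaryReductionAt v)
    (hEnd : EndTrivial B) :
    ρ₀.toGaloisRep.IsIrreducible ∧
      ∀ v : HeightOneSpectrum (𝓞 ℚ), ((p : ℕ) : 𝓞 ℚ) ∈ v.asIdeal →
        ρ₀.IsGreenbergOrdinaryOfShapeAt v ![0, 0, 1, 1] :=
  ⟨stub_tateModuleIrreducible hF hS p B b ρ₀ hfr hEnd,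
    fun v hv => stub_tateModuleGreenberg hST p B b ρ₀ hfr hdim v hv (hord v hv)⟩

/-! ## Stub 4 — the HONEST REMAINDER: the crux off the `p = 3` switchable sector (not claimed) -/

/-- **Stub 4 (`stub_offSectorRemainder`, OPEN — the remainder this line does NOT attack).**  For data
outside the sector — every odd `p ≠ 3`, and at `p = 3` every pair `(σ, σ')` with no switchable
`GSp₄(𝔽₃)`-model (no `𝔽₃`-model at all, e.g. `σ̄` genuinely over `𝔽₉` with `σ̄' ≠ σ̄^(3)`; or très
ramifié / non-ordinary-direction at `3`; or ramified at `2` / `Frob₂ ∈ 4C ∪ 12C`) — the crux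
`CruxAt p k red σ σ'` as filed.  This is EXACTLY the crux restricted off the sector: regimes R4
(generic `p ≥ 5`, `A₂(p)`-twists of general type — Hulek–Sankaran — so no Diophantine supply),
the dihedral D-residue and the `p = 3` leftovers of Disproof.lean §5; TRUE but settled elsewhere on
R1/D1 (functorial pairs, `cruxAt_of_automorphic_lift`).  Expected dimension `-1` (Disproof §6): no
engine is proposed here.  The lead should NOT try to prove it inside this line: hand it back
(`promote-stub`) — it is the natural second child of a planner split of the crux into
"`p = 3` switchable sector" (this line, closable modulo cited facts) + "the rest" (to be attacked by
`serre-dual-ribet-square`'s coherent Ribet square, or restated to `Irr'` by the tenure planner,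
Disproof `closes_irr'`, triage r1-1/2/3 bottom lines).
WHY IT MIGHT FAIL: it is the open problem itself (singular-weight deficit); a RIGID PAIR (Disproof
§3.4) off the sector refutes it and the crux with it.  Size: open (XL⁺).
[cite: HulekSankaran2002 (Kodaira dimension of A₂(p)); Sorensen2006; Sorensen2009; LemmaOchiai2023; HsiehPalvannan2025;
DeoPalvannan2026 arXiv:2602.20737] -/
theorem stub_offSectorRemainder :
    ∀ (p : ℕ) [Fact p.Prime], p ≠ 2 → ∀ (k : Type) [Field k] [CharP k p] [IsAlgClosed k]
      [TopologicalSpace k] [DiscreteTopology k] (red : Valued.integer (PadicAlgCl p) →+* k)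
      (σ σ' : FramedGaloisRep ℚ k 2),
      ¬ (p = 3 ∧ Switchable p k σ σ') → CruxAt p k red σ σ' := by
  sorry

/- **Sector theorem (`stub_sectorModuloFacts`) — LANDED** (p94938, 2026-08-16): `Theorems/PhantomRMYoshidaStableYoshidaCongruenceSector.lean`
proves, from the landed Stubs 1a/1b/2/3i/3ii, `(5 named facts) → ∀ p ≠ 2 … red σ σ', p = 3 → Switchable p k σ σ' → CruxAt p k red σ σ'`
(imported above).  Child A of the recommended planner split. -/


/-! ## Glue (sorry-free): the crux from the stubs -/

/-- **`StableYoshidaCongruence` from the line `level-three-weierstrass-switch`.**  Regime split on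
the sector `p = 3 ∧ Switchable p k σ σ'`.  IN the sector: the 2–3 switch (Stub 2) produces a modular
abelian surface `B` with framed `H¹ = ρ₀`, symplectic, residual pair `(σ, σ')`, automorphic; the
Tate-module dictionary (Stubs 3i/3ii) makes `ρ₀` irreducible and Greenberg-ordinary `(0,0,1,1)` at `3`;
residual distinguishedness is transferred from the H5-witness (Stubs 1a/1b); so `ρ₀` witnesses `CruxAt`.
OFF the sector: Stub 4 (the honest remainder).  `AutGL2`, `DetCond`, `NonConj` are threaded only into
Stub 4.  Reshape v4: the five named facts of Vocabulary IV enter as the registered `stub_fact_*`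
obligations (the gate forbids extra hypotheses on the deciding theorem). -/
theorem StableYoshidaCongruence_of : StableYoshidaCongruence := by
  refine crux_iff.mpr fun p _ hp k _ _ _ _ _ red σ σ' => ?_
  by_cases hsec : p = 3 ∧ Switchable p k σ σ'
  · -- the sector: Stubs 2, 3i, 3ii, 1a, 1b composed (= `stub_sectorModuloFacts`, whose landed proof is literally the
    -- term below with the fact stubs as hypotheses; kept inline here too so that the skeleton shows the data flow)
    exact stub_sectorModuloFacts stub_fact_faltingsTateBijective stub_fact_faltingsSemisimple
      stub_fact_serreTateOrdinaryFiltration stub_fact_bcgpSwitchModular stub_fact_weilPairing p hp k red σ σ'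
      hsec.1 hsec.2
  · exact stub_offSectorRemainder p hp k red σ σ' hsec

/-- The in-sector data flow, spelled out (the proof of `stub_sectorModuloFacts` in the Sector file): Stub 2 gives
`B, b, ρ₀`; the Tate-module dictionary (Stubs 3i/3ii) gives irreducibility and the Greenberg shape; the transfer
(Stubs 1a/1b) gives residual distinguishedness; `ρ₀` is the witness. -/
theorem cruxAt_of_sector (p : ℕ) [Fact p.Prime] (hp : p ≠ 2) (k : Type) [Field k] [CharP k p] [IsAlgClosed k]
    [TopologicalSpace k] [DiscreteTopology k] (red : Valued.integer (PadicAlgCl p) →+* k)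
    (σ σ' : FramedGaloisRep ℚ k 2) (hp3 : p = 3) (hsw : Switchable p k σ σ') : CruxAt p k red σ σ' := by
  intro hA hA' hirr hirr' hdet hnc hw hcpt ι
  obtain ⟨ρw, hSw⟩ := hw
  obtain ⟨B, b, ρ₀, hfr, hdim, hord, hEnd, hsymp, hpair, hAut⟩ :=
    stub_switchToModularSurface stub_fact_bcgpSwitchModular stub_fact_weilPairing p hp3 k red σ σ' hsw
  obtain ⟨hirr₀, hGr⟩ := tateModuleDictionary stub_fact_faltingsTateBijective stub_fact_faltingsSemisimple
    stub_fact_serreTateOrdinaryFiltration p B b ρ₀ hfr hdim hord hEnd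
  refine ⟨ρ₀, hirr₀, ⟨hsymp, fun v hv => ⟨hGr v hv, ?_⟩, hpair⟩, hAut hcpt ι⟩
  exact distinguishedTransfer p hp k red σ σ' ρw ρ₀ v hv hSw.2.2 hpair (hSw.2.1 v hv).2 (hGr v hv)

end Summit.Langlands.Langlands.Cruxes.StableYoshidaCongruence.LevelThreeWeierstrassSwitch
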